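import Literature.MathematicalPhysics.QuantumFieldTheory.Balaban1983to89.MassGapDobrushinNoGo
import HarnessLib

/-!
# Axial pair-sites meet `4(d−1)` plaquettes, and no plaquette holds two consecutive collinear links

HONEST FRAMING. Track Y4 (YM₃ infrared), theory-2. WHAT THIS IS: two kernel-checked COMBINATORIAL facts about
`ℤ^d` plaquettes (`plaquetteEdges`, `plaquettesTouching` of `LatticeGaugeDLR.lean`), the first bricks of the
post-Monday «high-temperature rung» for the AXIAL `b = 2` block family (`YM3IR/AxialFamily.lean`): conditioning
the Wilson law on an axial block average couples exactly the two consecutive collinear links of each axial line,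
so Dobrushin's technique must be run with PAIR-SITES; its row sum counts the plaquettes meeting a pair-site and the
number of sites per plaquette. WHAT THIS IS NOT: no Dobrushin estimate, no specification, no statement about any
measure, no conjecture name; nothing here is specific to `d = 3` or to a gauge group.

* `not_mem_plaquetteEdges_of_consecutive` — NO plaquette contains both `(x, i)` and `(x + eᵢ, i)`: the two links
  of a plaquette in a common direction differ by a unit vector in the OTHER direction.
* `disjoint_plaquettesTouching_consecutive` — hence the plaquette sets through the two links are disjoint, and
* `card_plaquettesTouching_axialPair` — an axial pair-site meets exactly `4(d−1)` plaquettes (`8` in `d = 3`),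
  twice the tree's one-link count `card_plaquettesTouching_singleton = 2(d−1)` (MassGapDobrushinNoGo.lean).
* `card_plaquetteEdges_eq` — a plaquette has exactly `4` edges (tree: `≤ 4`), hence meets `4` distinct sites of the
  pair-sited structure: the factor `|A| − 1 = 3` of Simon's criterion `Σ_{A ∋ s} (|A| − 1)‖Φ_A‖_∞ < 1`.

WHY THIS IS NOVEL (tree-relative, modest): the tree's Dobrushin pipeline for the Wilson specification
(`LatticeGaugeDobrushin.lean`) is LINK-sited; these are the two counting facts a pair-sited (block-constrained)
version needs, and they fix the hand count «8 plaquettes per pair-site, 4 sites per plaquette» of the cell's notes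
(HOME ym3ir/YM3-IR-theory2.md §12) in the kernel. [folklore]
-/

namespace Summit.Ventures.YMGap.YM3IR

open Literature.MathematicalPhysics.QuantumLattice
open Literature.MathematicalPhysics.QuantumFieldTheory (mem_plaquettesTouching_singleton)
open Literature.MathematicalPhysics.QuantumFieldTheory.Balaban1983to89.Sufficient (card_plaquettesTouching_singleton)
open Literature.Probability.LatticeModels (Site)

variable {d : ℕ}

/-- **No plaquette contains two consecutive collinear links.** If `(x, i)` and `(x + eᵢ, i)` were both edges of
the plaquette `p = (y, a, b)`, `a < b`, then (the two direction-`i` edges of `p` being `(y, i)` and `(y + e_c, i)`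
with `c` the other direction) we would get `eᵢ = ± e_c` or `eᵢ = 0`, impossible. [folklore] -/
theorem not_mem_plaquetteEdges_of_consecutive (p : ZdPlaquette d) (x : Site d) (i : Fin d)
    (h₁ : (x, i) ∈ plaquetteEdges p) (h₂ : (x + Pi.single i 1, i) ∈ plaquetteEdges p) : False := by
  obtain ⟨y, ⟨⟨a, b⟩, hab⟩⟩ := p
  have hab' : a ≠ b := ne_of_lt hab
  simp only [plaquetteEdges, Finset.mem_insert, Finset.mem_singleton, Prod.mk.injEq] at h₁ h₂
  -- every case produces an identity between lattice vectors that fails at one coordinate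
  have key : ∀ (u v : Site d), x = u → x + Pi.single i 1 = v →
      v - u = Pi.single i 1 := by
    rintro u v rfl rfl; simp
  rcases h₁ with ⟨hx₁, hi₁⟩ | ⟨hx₁, hi₁⟩ | ⟨hx₁, hi₁⟩ | ⟨hx₁, hi₁⟩ <;>
    rcases h₂ with ⟨hx₂, hi₂⟩ | ⟨hx₂, hi₂⟩ | ⟨hx₂, hi₂⟩ | ⟨hx₂, hi₂⟩ <;>
    first
      | exact hab' (hi₁.symm.trans hi₂)
      | exact hab' (hi₂.symm.trans hi₁)
      | (have e' := congrFun (key _ _ hx₁ hx₂) i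
         subst hi₁
         simp [hab', hab'.symm] at e')

/-- The plaquette sets through two consecutive collinear links are disjoint. [folklore] -/
theorem disjoint_plaquettesTouching_consecutive (x : Site d) (i : Fin d) :
    Disjoint (plaquettesTouching {(x, i)}) (plaquettesTouching {(x + Pi.single i 1, i)}) := by
  classical
  rw [Finset.disjoint_left]
  intro p h₁ h₂
  exact not_mem_plaquetteEdges_of_consecutive p x i (mem_plaquettesTouching_singleton.1 h₁)
    (mem_plaquettesTouching_singleton.1 h₂)

/-- `plaquettesTouching` of a pair is the union of the two singletons' sets. [folklore] -/
theorem plaquettesTouching_pair (e₁ e₂ : ZdEdge d) :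
    plaquettesTouching ({e₁, e₂} : Finset (Literature.MathematicalPhysics.QuantumLattice.ZdEdge d)) = plaquettesTouching {e₁} ∪ plaquettesTouching {e₂} := by
  classical
  ext p
  rw [Finset.mem_union, mem_plaquettesTouching_iff, mem_plaquettesTouching_singleton,
    mem_plaquettesTouching_singleton]
  constructor
  · rintro ⟨e, he⟩
    rw [Finset.mem_inter, Finset.mem_insert, Finset.mem_singleton] at he
    rcases he with ⟨he, rfl | rfl⟩
    · exact Or.inl he
    · exact Or.inr he
  · rintro (h | h)
    · exact ⟨e₁, Finset.mem_inter.2 ⟨h, by simp⟩⟩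
    · exact ⟨e₂, Finset.mem_inter.2 ⟨h, by simp⟩⟩

/-- **An axial pair-site meets exactly `4(d−1)` plaquettes** (`8` in `d = 3`): the two consecutive collinear
links `(x, i)`, `(x + eᵢ, i)` lie in `2(d−1)` plaquettes each (`card_plaquettesTouching_singleton`) and in no
common one (`disjoint_plaquettesTouching_consecutive`). This is the plaquette count in the Dobrushin row sum of a
pair-sited (axially block-constrained) Wilson specification. [folklore] -/
theorem card_plaquettesTouching_axialPair (x : Site d) (i : Fin d) :
    (plaquettesTouching ({(x, i), (x + Pi.single i 1, i)} : Finset (Literature.MathematicalPhysics.QuantumLattice.ZdEdge d))).card = 4 * (d - 1) := by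
  classical
  rw [plaquettesTouching_pair, Finset.card_union_of_disjoint (disjoint_plaquettesTouching_consecutive x i),
    card_plaquettesTouching_singleton, card_plaquettesTouching_singleton]
  ring

/-- The `d = 3` instance: an axial pair-site of the YM₃ lattice meets exactly `8` plaquettes. [folklore] -/
theorem card_plaquettesTouching_axialPair_dim3 (x : Site 3) (i : Fin 3) :
    (plaquettesTouching ({(x, i), (x + Pi.single i 1, i)} : Finset (Literature.MathematicalPhysics.QuantumLattice.ZdEdge 3))).card = 8 := by
  rw [card_plaquettesTouching_axialPair]

/-- **A plaquette has exactly four edges** (the tree's `card_plaquetteEdges_le` is the upper bound): `(y, a)`,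
`(y + e_a, b)`, `(y + e_b, a)`, `(y, b)` are pairwise distinct for `a < b`. Together with
`not_mem_plaquetteEdges_of_consecutive` (no two of them form an axial pair) this says every plaquette meets
exactly FOUR distinct sites of the pair-sited structure — the factor `|A| − 1 = 3` in Simon's form of Dobrushin's
criterion. [folklore] -/
theorem card_plaquetteEdges_eq (p : ZdPlaquette d) : (plaquetteEdges p).card = 4 := by
  classical
  obtain ⟨y, ⟨⟨a, b⟩, hab⟩⟩ := p
  have hab' : a ≠ b := ne_of_lt hab
  have ha : (Pi.single a (1 : ℤ) : Site d) a = 1 := by simp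
  have hb : (Pi.single b (1 : ℤ) : Site d) b = 1 := by simp
  have h1 : (y, a) ∉ ({(y + Pi.single a 1, b), (y + Pi.single b 1, a), (y, b)} :
      Finset (Literature.MathematicalPhysics.QuantumLattice.ZdEdge d)) := by
    simp only [Finset.mem_insert, Finset.mem_singleton, Prod.mk.injEq, not_or, not_and]
    refine ⟨fun _ => hab', fun h => ?_, fun _ => hab'⟩
    have := congrFun h b; simp at this
  have h2 : (y + Pi.single a 1, b) ∉ ({(y + Pi.single b 1, a), (y, b)} :
      Finset (Literature.MathematicalPhysics.QuantumLattice.ZdEdge d)) := by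
    simp only [Finset.mem_insert, Finset.mem_singleton, Prod.mk.injEq, not_or, not_and]
    refine ⟨fun _ => hab'.symm, fun h => ?_⟩
    have := congrFun h a; simp at this
  have h3 : (y + Pi.single b 1, a) ∉ ({(y, b)} :
      Finset (Literature.MathematicalPhysics.QuantumLattice.ZdEdge d)) := by
    simp only [Finset.mem_singleton, Prod.mk.injEq, not_and]
    exact fun _ => hab'
  simp only [plaquetteEdges]
  rw [Finset.card_insert_of_notMem h1, Finset.card_insert_of_notMem h2, Finset.card_insert_of_notMem h3,
    Finset.card_singleton]

end Summit.Ventures.YMGap.YM3IR
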